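import Summits.HodgeConjecture.CorCM.GaloisSemidihedralModularDegenerateTypes
import HarnessLib

/-!
# Every SPLIT METACYCLIC Galois group `C_{2h} ⋊_u C₂` with `u ≠ ±1`: the double interval is a primitive degenerate
# CM type — simple degenerate CM abelian varieties of dimension `2h`

COR-CM (cell `pub-hodgecm2`), binder seat b04 (gen 22), count-neutral claim GALOIS-DIHEDRAL, part X — the general form
of part VIII (`CorCM/GaloisSemidihedralModularDegenerateTypes`, `u = h ∓ 1`).  KERNEL ONLY: theorems; no definition, no
named fact, no `sorry`.  `HC_CM` is neither used nor claimed.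

SETTING (inside `G = Gal(K/ℚ)`).  `α, ξ ∈ G`, `ord α = 2h`, `ξ ∉ ⟨α⟩`, `ξ² = 1`, `|G| = 4h`, `ξ α = α^{u₀} ξ`; so
`G = C_{2h} ⋊_u C₂` is a split metacyclic group (`u = u₀ mod 2h`).  Automatically `u² = 1` (§1 `u_mul_u`, from
`ξ² = 1`), hence `u` is odd and `u·h = h` (§1 `u_mul_h`), and `j ↦ u j` fixes `0` and `h`; complex conjugation is
`α^h` as soon as `u ≠ 1` (§2).  THE DICHOTOMY: `u = 1` is `C_{2h} × C₂` (GOOD when `c ∈ C_{2h}`, gen 15 (α));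
`u = −1` is the dihedral group (part IV: good iff `4h ≤ 16`); and for EVERY OTHER `u` —
**`exists_simple_degenerate_of_splitMetacyclic`** (§3) — the DOUBLE INTERVAL `{αⁱ, αⁱξ : i < h}` is a PRIMITIVE
DEGENERATE CM type: balanced against `{1, α^{h−1}, α^h ξ, α^{2h−1} ξ}` exactly as in part VIII (the count
`2 + [j=0] − [j=h] + [uj=h] − [uj=0] = 2` needs only `u² = 1`, `u h = h`), and of trivial left stabiliser because
`j + u·[0,h) = [0,h)` forces `u = ±1`: under the affine bijection `i ↦ j + u i` of `ℤ/2h` preserving the interval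
`H₀ = [0, h)`, EXACTLY ONE `y ∈ H₀` has `y + u ∉ H₀` (the image of `h − 1`), whereas for `2 ≤ u ≤ h` both `h−1, h−2`
and for `h < u ≤ 2h−2` both `0, 1` are such `y`.  So a Galois CM field with such a Galois group (`h ≥ 4`) has a SIMPLE
DEGENERATE abelian variety of dimension `2h` — e.g. the groups `C_m × D_{4n}` (`m > 1` odd, `c = r^{n}`; `u ≡ −1` on
the `2`-part, `≡ 1` on the odd part), `C_m × SD_{2^k}`, `C_m × M_{2^k}`, `C₄ × S₃`, `C₃ × D₄` (gen 20 VII), `SD_{2^k}`,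
`M_{2^k}` (part VIII), …: every non-abelian split extension of a cyclic group by an involution other than the dihedral
one.

## References

* [Shimura1998] G. Shimura, *Abelian Varieties with Complex Multiplication and Modular Functions*, §6.2 Thm. 3,
  §8.2 Prop. 26, §18.2 Lemma (i).
* [Gordon1999HodgeAVSurvey] B. B. Gordon, *A survey of the Hodge conjecture for abelian varieties*, Thm. 6.4, §9.3.
* [Kubota1965] T. Kubota, Trans. AMS 118 (1965), §2.
-/

noncomputable section

open CategoryTheory CategoryTheory.Limits NumberField
open scoped BigOperators

namespace Summit.HodgeConjecture.CorCM.GaloisSemidihedral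

open Literature.NumberTheory.ComplexMultiplication
open Literature.AlgebraicGeometry.Motives (AbelianVariety CMType)
open Literature.AlgebraicGeometry.HodgeTheory
open Literature.AlgebraicGeometry.ComplexMultiplication (IsCMTypeRealisation)
open Literature.AlgebraicGeometry.Pohlmann1968
open Literature.Barriers.HodgeConjecture (divisorClassesSpan)
open Summit.HodgeConjecture.CorCM.GaloisModels
open Summit.HodgeConjecture.CorCM.CyclicAsymmetricHalves

/-! ## §1 `u² = 1`, `u h = h`, and the fixed points `0, h` of `j ↦ u j` -/

section Arith

variable {G : Type*} [Group G] {α ξ : G} {h u₀ : ℕ}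

/-- **`u² = 1` in `ℤ/2h`** from `ξ² = 1`: `α = ξ²αξ⁻² = α^{u²}`. [folklore] -/
theorem u_mul_u [NeZero h] (hord : orderOf α = 2 * h) (hξ2 : ξ * ξ = 1) (hrel : ξ * α = α ^ u₀ * ξ) :
    (u₀ : ZMod (2 * h)) * u₀ = 1 := by
  haveI : NeZero (2 * h) := ⟨by have := NeZero.ne h; omega⟩
  have h1 : ξ * (ξ * α) = α ^ (u₀ * u₀) * (ξ * ξ) := by
    calc ξ * (ξ * α) = ξ * (α ^ u₀ * ξ) := by rw [hrel]
      _ = (ξ * α ^ u₀) * ξ := by rw [mul_assoc]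
      _ = (α ^ (u₀ * u₀) * ξ) * ξ := by rw [xi_mul_pow hrel]
      _ = α ^ (u₀ * u₀) * (ξ * ξ) := by rw [mul_assoc]
  rw [← mul_assoc, hξ2, one_mul, mul_one] at h1
  have h2 : α ^ (1 : ℕ) = α ^ (u₀ * u₀) := by rw [pow_one]; exact h1
  rw [pow_eq_pow_iff_modEq, hord] at h2
  have h3 := (ZMod.natCast_eq_natCast_iff' 1 (u₀ * u₀) (2 * h)).2 h2
  rw [Nat.cast_one, Nat.cast_mul] at h3
  exact h3.symm

/-- **`u h = h` in `ℤ/2h`**: `u` is odd since `u² ≡ 1 (mod 2h)`. [folklore] -/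
theorem u_mul_h [NeZero h] (hu : (u₀ : ZMod (2 * h)) * u₀ = 1) : (u₀ : ZMod (2 * h)) * h = h := by
  haveI : NeZero (2 * h) := ⟨by have := NeZero.ne h; omega⟩
  have hpos : 0 < h := Nat.pos_of_ne_zero (NeZero.ne h)
  -- `u₀` is odd
  have hodd : Odd u₀ := by
    by_contra heven
    rw [Nat.not_odd_iff_even] at heven
    obtain ⟨k, hk⟩ := heven
    have hval := congrArg ZMod.val hu
    rw [ZMod.val_mul, ZMod.val_natCast, Nat.mul_mod, Nat.mod_mod, ← Nat.mul_mod] at hval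
    haveI : Fact (1 < 2 * h) := ⟨by omega⟩
    rw [ZMod.val_one] at hval
    have hdvd : 2 ∣ u₀ * u₀ := ⟨k * u₀, by rw [hk]; ring⟩
    have h2 : 2 ∣ (u₀ * u₀) % (2 * h) := (Nat.dvd_mod_iff (dvd_mul_right 2 h)).2 hdvd
    rw [hval] at h2
    omega
  obtain ⟨w, hw⟩ := hodd
  have hcast : ((u₀ * h : ℕ) : ZMod (2 * h)) = ((h : ℕ) : ZMod (2 * h)) := by
    rw [hw, show (2 * w + 1) * h = 2 * h * w + h by ring, Nat.cast_add, Nat.cast_mul, ZMod.natCast_self, zero_mul,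
      zero_add]
  exact_mod_cast hcast

/-- `u j = 0 ↔ j = 0` and `u j = h ↔ j = h`. [folklore] -/
theorem mul_fixes [NeZero h] (hu : (u₀ : ZMod (2 * h)) * u₀ = 1) (j : ZMod (2 * h)) :
    ((u₀ : ZMod (2 * h)) * j = 0 ↔ j = 0) ∧ ((u₀ : ZMod (2 * h)) * j = h ↔ j = h) := by
  have huh := u_mul_h hu
  refine ⟨⟨fun h0 => ?_, fun h0 => by rw [h0, mul_zero]⟩, ⟨fun hh => ?_, fun hh => by rw [hh, huh]⟩⟩
  · calc j = (u₀ : ZMod (2 * h)) * ((u₀ : ZMod (2 * h)) * j) := by rw [← mul_assoc, hu, one_mul]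
      _ = 0 := by rw [h0, mul_zero]
  · calc j = (u₀ : ZMod (2 * h)) * ((u₀ : ZMod (2 * h)) * j) := by rw [← mul_assoc, hu, one_mul]
      _ = h := by rw [hh, huh]

end Arith

/-! ## §2 The double interval for a general `u ≠ ±1`: complex conjugation, balance, left stabiliser -/

section General

variable {G : Type*} [Group G] [Fintype G] [DecidableEq G] {α ξ : G} {h u₀ : ℕ} {T : Finset G}

omit [DecidableEq G] in
/-- **The only central involution is `α^h`** when `u ≠ 1`. [cite: Shimura1998, §18.2 Lemma (i)] -/
theorem central_involution_eq_pow' (h2 : 2 ≤ h) (hord : orderOf α = 2 * h) (hξ : ξ ∉ Subgroup.zpowers α)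
    (hrel : ξ * α = α ^ u₀ * ξ) (hu1 : (u₀ : ZMod (2 * h)) ≠ 1) (hcard : Fintype.card G = 4 * h) (c : G)
    (hc1 : c * c = 1) (hc2 : c ≠ 1) (hcomm : ∀ y : G, c * y = y * c) : c = α ^ h := by
  haveI : NeZero h := ⟨by omega⟩
  haveI : NeZero (2 * h) := ⟨by omega⟩
  obtain ⟨x, rfl | rfl⟩ := exists_normalForm hord hξ hcard c
  · have hxx : x + x = 0 := by
      have h1 : α ^ (x + x).val = α ^ (0 : ZMod (2 * h)).val := by
        rw [pow_val_add hord, hc1, ZMod.val_zero, pow_zero]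
      exact (pow_val_inj hord).1 h1
    have hx0 : x.val ≠ 0 := fun h0 => hc2 (by rw [h0, pow_zero])
    have hlt := x.val_lt
    have hcast : ((x.val + x.val : ℕ) : ZMod (2 * h)) = 0 := by
      rw [Nat.cast_add, ZMod.natCast_zmod_val, hxx]
    rw [ZMod.natCast_eq_zero_iff] at hcast
    obtain ⟨q, hq⟩ := hcast
    have hq1 : q = 1 := by
      rcases Nat.lt_or_ge q 2 with hq2 | hq2
      · interval_cases q <;> omega
      · nlinarith
    rw [hq1, mul_one] at hq
    rw [show x.val = h by omega]
  · exfalso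
    have h1 := hcomm (α ^ ((1 : ℕ) : ZMod (2 * h)).val)
    rw [refl_mul_rot hord hrel, rot_mul_refl hord] at h1
    have h2' := (pow_val_inj hord).1 (mul_right_cancel h1)
    rw [Nat.cast_one, mul_one, add_comm] at h2'
    exact hu1 (add_right_cancel h2')

/-- **THE BALANCED SET** for a general `u` with `u² = 1`: `2 · #{x ∈ D : x g ∈ T} = 4`.
[cite: Gordon1999HodgeAVSurvey, §9.3] -/
theorem doubleInterval_balanced' (h4 : 4 ≤ h) (hord : orderOf α = 2 * h) (hξ : ξ ∉ Subgroup.zpowers α)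
    (hrel : ξ * α = α ^ u₀ * ξ) (hξ2 : ξ * ξ = 1) (hcard : Fintype.card G = 4 * h)
    (hTr : ∀ x : ZMod (2 * h), α ^ x.val ∈ T ↔ x.val < h)
    (hTx : ∀ x : ZMod (2 * h), α ^ x.val * ξ ∈ T ↔ x.val < h) (g : G) :
    2 * (({(1 : G), α ^ ((h - 1 : ℕ) : ZMod (2 * h)).val,
        α ^ ((h : ℕ) : ZMod (2 * h)).val * ξ, α ^ ((2 * h - 1 : ℕ) : ZMod (2 * h)).val * ξ} : Finset G).filter
        fun x => x * g ∈ T).card = 4 := by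
  haveI : NeZero h := ⟨by omega⟩
  haveI : NeZero (2 * h) := ⟨by omega⟩
  have hu := u_mul_u hord hξ2 hrel
  obtain ⟨hne12, hne13, hne14, hne23, hne24, hne34⟩ := doubleInterval_D_distinct h4 hord hξ
  have hz := fun j => (mul_fixes hu j).1
  have hh := fun j => (mul_fixes hu j).2
  have e : ∀ z : ZMod (2 * h), z.val = h ↔ z = ((h : ℕ) : ZMod (2 * h)) := fun z => by
    constructor
    · intro hzv; apply ZMod.val_injective; rw [hzv, val_natCast_of_lt' (show h < 2 * h by omega)]
    · intro hzv; rw [hzv, val_natCast_of_lt' (show h < 2 * h by omega)]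
  have hn1 : (1 : G) ∉ ({α ^ ((h - 1 : ℕ) : ZMod (2 * h)).val, α ^ ((h : ℕ) : ZMod (2 * h)).val * ξ,
      α ^ ((2 * h - 1 : ℕ) : ZMod (2 * h)).val * ξ} : Finset G) := by
    simp only [Finset.mem_insert, Finset.mem_singleton, not_or]; exact ⟨hne12, hne13, hne14⟩
  have hn2 : α ^ ((h - 1 : ℕ) : ZMod (2 * h)).val ∉ ({α ^ ((h : ℕ) : ZMod (2 * h)).val * ξ,
      α ^ ((2 * h - 1 : ℕ) : ZMod (2 * h)).val * ξ} : Finset G) := by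
    simp only [Finset.mem_insert, Finset.mem_singleton, not_or]; exact ⟨hne23, hne24⟩
  have hn3 : α ^ ((h : ℕ) : ZMod (2 * h)).val * ξ ∉ ({α ^ ((2 * h - 1 : ℕ) : ZMod (2 * h)).val * ξ} : Finset G) := by
    simp only [Finset.mem_singleton]; exact hne34
  rw [Finset.card_filter, Finset.sum_insert hn1, Finset.sum_insert hn2, Finset.sum_insert hn3, Finset.sum_singleton]
  obtain ⟨j, rfl | rfl⟩ := exists_normalForm hord hξ hcard g
  · have m1 : (1 : G) * α ^ j.val ∈ T ↔ j.val < h := by rw [one_mul, hTr]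
    have m2 : α ^ ((h - 1 : ℕ) : ZMod (2 * h)).val * α ^ j.val ∈ T ↔ (j.val = 0 ∨ h + 1 ≤ j.val) := by
      rw [← pow_val_add hord, hTr, add_comm, val_add_natCast_eq j (show h - 1 < 2 * h by omega)]
      have := j.val_lt
      split_ifs <;> omega
    have m3 : α ^ ((h : ℕ) : ZMod (2 * h)).val * ξ * α ^ j.val ∈ T ↔ h ≤ ((u₀ : ZMod (2 * h)) * j).val := by
      rw [refl_mul_rot hord hrel, hTx, add_comm, val_add_natCast_eq _ (show h < 2 * h by omega)]
      have := ((u₀ : ZMod (2 * h)) * j).val_lt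
      split_ifs <;> omega
    have m4 : α ^ ((2 * h - 1 : ℕ) : ZMod (2 * h)).val * ξ * α ^ j.val ∈ T ↔
        (1 ≤ ((u₀ : ZMod (2 * h)) * j).val ∧ ((u₀ : ZMod (2 * h)) * j).val ≤ h) := by
      rw [refl_mul_rot hord hrel, hTx, add_comm, val_add_natCast_eq _ (show 2 * h - 1 < 2 * h by omega)]
      have := ((u₀ : ZMod (2 * h)) * j).val_lt
      split_ifs <;> omega
    have k0 : ((u₀ : ZMod (2 * h)) * j).val = 0 ↔ j.val = 0 := by
      rw [ZMod.val_eq_zero, ZMod.val_eq_zero]; exact hz j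
    have kh : ((u₀ : ZMod (2 * h)) * j).val = h ↔ j.val = h := by rw [e, e]; exact hh j
    have hj := j.val_lt
    have hb := ((u₀ : ZMod (2 * h)) * j).val_lt
    simp only [m1, m2, m3, m4]
    split_ifs <;> omega
  · have m1 : (1 : G) * (α ^ j.val * ξ) ∈ T ↔ j.val < h := by rw [one_mul, hTx]
    have m2 : α ^ ((h - 1 : ℕ) : ZMod (2 * h)).val * (α ^ j.val * ξ) ∈ T ↔ (j.val = 0 ∨ h + 1 ≤ j.val) := by
      rw [rot_mul_refl hord, hTx, add_comm, val_add_natCast_eq j (show h - 1 < 2 * h by omega)]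
      have := j.val_lt
      split_ifs <;> omega
    have m3 : α ^ ((h : ℕ) : ZMod (2 * h)).val * ξ * (α ^ j.val * ξ) ∈ T ↔ h ≤ ((u₀ : ZMod (2 * h)) * j).val := by
      rw [refl_mul_refl hord hrel hξ2, hTr, add_comm, val_add_natCast_eq _ (show h < 2 * h by omega)]
      have := ((u₀ : ZMod (2 * h)) * j).val_lt
      split_ifs <;> omega
    have m4 : α ^ ((2 * h - 1 : ℕ) : ZMod (2 * h)).val * ξ * (α ^ j.val * ξ) ∈ T ↔
        (1 ≤ ((u₀ : ZMod (2 * h)) * j).val ∧ ((u₀ : ZMod (2 * h)) * j).val ≤ h) := by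
      rw [refl_mul_refl hord hrel hξ2, hTr, add_comm, val_add_natCast_eq _ (show 2 * h - 1 < 2 * h by omega)]
      have := ((u₀ : ZMod (2 * h)) * j).val_lt
      split_ifs <;> omega
    have k0 : ((u₀ : ZMod (2 * h)) * j).val = 0 ↔ j.val = 0 := by
      rw [ZMod.val_eq_zero, ZMod.val_eq_zero]; exact hz j
    have kh : ((u₀ : ZMod (2 * h)) * j).val = h ↔ j.val = h := by rw [e, e]; exact hh j
    have hj := j.val_lt
    have hb := ((u₀ : ZMod (2 * h)) * j).val_lt
    simp only [m1, m2, m3, m4]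
    split_ifs <;> omega

/-- **TRIVIAL LEFT STABILISER for every `u ≠ ±1`**: a stabilising `α^j ξ` gives the affine bijection `i ↦ j + u i`
of `ℤ/2h` preserving `[0, h)`, under which exactly one `y ∈ [0,h)` has `y + u ∉ [0,h)`; but there are two.
[cite: Shimura1998, §8.2 Prop. 26] -/
theorem doubleInterval_leftStabiliser' (h4 : 4 ≤ h) (hord : orderOf α = 2 * h) (hξ : ξ ∉ Subgroup.zpowers α)
    (hrel : ξ * α = α ^ u₀ * ξ) (hξ2 : ξ * ξ = 1) (hu1 : (u₀ : ZMod (2 * h)) ≠ 1)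
    (hu2 : (u₀ : ZMod (2 * h)) ≠ -1) (hcard : Fintype.card G = 4 * h)
    (hTr : ∀ x : ZMod (2 * h), α ^ x.val ∈ T ↔ x.val < h)
    (hTx : ∀ x : ZMod (2 * h), α ^ x.val * ξ ∈ T ↔ x.val < h) (v : G) (hv : v ≠ 1) :
    ∃ w : G, ¬ (w ∈ T ↔ v * w ∈ T) := by
  haveI : NeZero h := ⟨by omega⟩
  haveI : NeZero (2 * h) := ⟨by omega⟩
  have hu := u_mul_u hord hξ2 hrel
  obtain ⟨j, rfl | rfl⟩ := exists_normalForm hord hξ hcard v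
  · -- `v = α^j`, `j ≠ 0`
    have hj : j.val ≠ 0 := fun h0 => hv (by rw [h0, pow_zero])
    have hjlt := j.val_lt
    by_cases hjh : j.val < h
    · refine ⟨α ^ ((((h : ℕ) : ZMod (2 * h)) - j)).val, fun hiff => ?_⟩
      rw [← pow_val_add hord, add_sub_cancel, hTr, hTr, val_natCast_sub_eq j (show h < 2 * h by omega),
        val_natCast_of_lt' (show h < 2 * h by omega)] at hiff
      split_ifs at hiff <;> omega
    · refine ⟨α ^ ((0 : ZMod (2 * h))).val, fun hiff => ?_⟩
      rw [← pow_val_add hord, add_zero, hTr, hTr, ZMod.val_zero] at hiff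
      omega
  · -- `v = α^j ξ`
    by_contra hall
    push Not at hall
    set u : ZMod (2 * h) := (u₀ : ZMod (2 * h)) with hu_def
    -- the biconditional on the rotation sheet: `i ∈ H₀ ↔ j + u i ∈ H₀`
    have P : ∀ i : ZMod (2 * h), i.val < h ↔ (j + u * i).val < h := fun i => by
      have := hall (α ^ i.val)
      rwa [refl_mul_rot hord hrel, hTr, hTx] at this
    -- for `y = j + u i`: if `y ∈ H₀` and `y + u ∉ H₀` then `i.val = h - 1`
    have uniq : ∀ i : ZMod (2 * h), (j + u * i).val < h → ¬ ((j + u * (i + 1)).val < h) → i.val = h - 1 :=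
      fun i hy hyu => by
      have hi : i.val < h := (P i).2 hy
      have hi1 : ¬ ((i + 1).val < h) := fun h' => hyu ((P (i + 1)).1 h')
      have := val_add_natCast_eq i (show 1 < 2 * h by omega)
      rw [Nat.cast_one] at this
      rw [this] at hi1
      split_ifs at hi1 <;> omega
    -- the preimages of `y` and `y'`
    have pre : ∀ y : ZMod (2 * h), j + u * (u * (y - j)) = y := fun y => by
      rw [← mul_assoc, hu, one_mul, add_sub_cancel]
    have step : ∀ y : ZMod (2 * h), j + u * (u * (y - j) + 1) = y + u := fun y => by
      rw [mul_add, mul_one, ← add_assoc, pre]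
    have key : ∀ y : ZMod (2 * h), y.val < h → ¬ ((y + u).val < h) → (u * (y - j)).val = h - 1 := fun y hy hyu =>
      uniq _ (by rwa [pre]) (by rwa [step])
    have hb := u.val_lt
    haveI : Fact (1 < 2 * h) := ⟨by omega⟩
    have hb1 : u.val ≠ 1 := fun h1 => hu1 (by
      apply ZMod.val_injective; rw [h1, ZMod.val_one])
    have hbm : u.val ≠ 2 * h - 1 := fun h1 => hu2 (by
      apply ZMod.val_injective
      rw [h1, ZMod.neg_val, if_neg (one_ne_zero), ZMod.val_one])
    have hb0 : u.val ≠ 0 := fun h0 => by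
      have : u = 0 := (ZMod.val_eq_zero u).1 h0
      rw [this, zero_mul] at hu
      exact zero_ne_one hu
    -- two witnesses `y` with `y ∈ H₀`, `y + u ∉ H₀`
    rcases Nat.lt_or_ge u.val (h + 1) with hsmall | hlarge
    · -- `2 ≤ u ≤ h`: `y = h - 1` and `y = h - 2`
      have w1 := key ((h - 1 : ℕ) : ZMod (2 * h)) (by rw [val_natCast_of_lt' (by omega)]; omega) (by
        have hu' : u = ((u.val : ℕ) : ZMod (2 * h)) := (ZMod.natCast_zmod_val u).symm
        rw [hu', ← Nat.cast_add, val_natCast_of_lt' (show h - 1 + u.val < 2 * h by omega)]; omega)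
      have w2 := key ((h - 2 : ℕ) : ZMod (2 * h)) (by rw [val_natCast_of_lt' (by omega)]; omega) (by
        have hu' : u = ((u.val : ℕ) : ZMod (2 * h)) := (ZMod.natCast_zmod_val u).symm
        rw [hu', ← Nat.cast_add, val_natCast_of_lt' (show h - 2 + u.val < 2 * h by omega)]; omega)
      have heq : u * (((h - 1 : ℕ) : ZMod (2 * h)) - j) = u * (((h - 2 : ℕ) : ZMod (2 * h)) - j) := by
        apply ZMod.val_injective; rw [w1, w2]
      have heq' : ((h - 1 : ℕ) : ZMod (2 * h)) = ((h - 2 : ℕ) : ZMod (2 * h)) := by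
        have := congrArg (fun z => j + u * z) heq
        simp only [pre] at this
        exact this
      have := congrArg ZMod.val heq'
      rw [val_natCast_of_lt' (show h - 1 < 2 * h by omega), val_natCast_of_lt' (show h - 2 < 2 * h by omega)]
        at this
      omega
    · -- `h + 1 ≤ u ≤ 2h - 2`: `y = 0` and `y = 1`
      have w1 := key ((0 : ℕ) : ZMod (2 * h)) (by rw [val_natCast_of_lt' (by omega)]; omega) (by
        rw [Nat.cast_zero, zero_add]; omega)
      have w2 := key ((1 : ℕ) : ZMod (2 * h)) (by rw [val_natCast_of_lt' (by omega)]; omega) (by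
        have hu' : u = ((u.val : ℕ) : ZMod (2 * h)) := (ZMod.natCast_zmod_val u).symm
        rw [hu', ← Nat.cast_add, val_natCast_of_lt' (show 1 + u.val < 2 * h by omega)]; omega)
      have heq : u * (((0 : ℕ) : ZMod (2 * h)) - j) = u * (((1 : ℕ) : ZMod (2 * h)) - j) := by
        apply ZMod.val_injective; rw [w1, w2]
      have heq' : ((0 : ℕ) : ZMod (2 * h)) = ((1 : ℕ) : ZMod (2 * h)) := by
        have := congrArg (fun z => j + u * z) heq
        simp only [pre] at this
        exact this
      have := congrArg ZMod.val heq'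
      rw [val_natCast_of_lt' (show 0 < 2 * h by omega), val_natCast_of_lt' (show 1 < 2 * h by omega)] at this
      omega

end General

/-! ## §3 Field level -/

section Field

variable {K : Type} [Field K] [NumberField K] [IsCMField K] [IsGalois ℚ K]

/-- **THEOREM (split metacyclic Galois groups `C_{2h} ⋊_u C₂`, `u ≠ ±1`).**  `K` Galois CM, `α, ξ ∈ Gal(K/ℚ)` with
`ord α = 2h` (`h ≥ 4`), `ξ ∉ ⟨α⟩`, `ξ² = 1`, `ξ α = α^{u₀} ξ`, `[K:ℚ] = 4h`, and `u₀ ≢ ±1 (mod 2h)`: then `K` has a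
SIMPLE DEGENERATE abelian variety of dimension `2h` with CM by `K`, with an exceptional Hodge class on some power — the
double interval `{αⁱ, αⁱ ξ : i < h}` is a primitive degenerate CM type (complex conjugation `= α^h` is derived).
[cite: Shimura1998, §6.2 Thm. 3 and §8.2 Prop. 26] [cite: Gordon1999HodgeAVSurvey, Thm. 6.4 and §9.3] [cite: Kubota1965, §2] -/
theorem exists_simple_degenerate_of_splitMetacyclic {h u₀ : ℕ} (h4 : 4 ≤ h) (α ξ : K ≃ₐ[ℚ] K)
    (hord : orderOf α = 2 * h) (hξ : ξ ∉ Subgroup.zpowers α) (hξ2 : ξ * ξ = 1) (hrel : ξ * α = α ^ u₀ * ξ)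
    (hu1 : (u₀ : ZMod (2 * h)) ≠ 1) (hu2 : (u₀ : ZMod (2 * h)) ≠ -1) (hK : Module.finrank ℚ K = 4 * h) :
    ∃ (Φ : CMType K) (φ₀ : K →+* ℂ) (A : AbelianVariety ℂ) (ι : 𝓞 K →+* End A)
      (θ : K →+* Module.End ℂ (complexBetti A.X 1)),
      IsPrimitive (ℂ ≃+* ℂ) Φ.1 φ₀ ∧ ¬ IsNondegenerate Φ ∧ IsCMTypeRealisation Φ A ι θ ∧ A.IsSimple ∧
      A.dim = 2 * h ∧
      ∃ n p : ℕ, ∃ x : complexBetti (⨁ fun _ : Fin n => A).X (2 * p), IsRationalClass x ∧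
        IsOfHodgeType (⨁ fun _ : Fin n => A).dim (⨁ fun _ : Fin n => A).X (2 * p) p p x ∧
        x ∉ divisorClassesSpan (⨁ fun _ : Fin n => A).X (⨁ fun _ : Fin n => A).dim p := by
  classical
  haveI : NeZero h := ⟨by omega⟩
  haveI : NeZero (2 * h) := ⟨by omega⟩
  have hcard : Fintype.card (K ≃ₐ[ℚ] K) = 4 * h := by
    rw [← hK, ← IsGalois.card_aut_eq_finrank, Nat.card_eq_fintype_card]
  have hc : (IsCMField.complexConj K).restrictScalars ℚ = α ^ h :=
    central_involution_eq_pow' (G := K ≃ₐ[ℚ] K) (by omega) hord hξ hrel hu1 hcard _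
      (GaloisRank.model_complexConj_mul_self (MulEquiv.refl _) rfl)
      (GaloisRank.model_complexConj_ne_one (MulEquiv.refl _) rfl)
      (GaloisRank.model_complexConj_comm (MulEquiv.refl _) rfl)
  obtain ⟨T, hTr, hTx⟩ := exists_doubleInterval (G := K ≃ₐ[ℚ] K) hord hξ
  have hαh : α ^ h = α ^ ((h : ℕ) : ZMod (2 * h)).val := by rw [val_natCast_of_lt' (show h < 2 * h by omega)]
  obtain ⟨hne12, hne13, hne14, hne23, hne24, hne34⟩ := doubleInterval_D_distinct (G := K ≃ₐ[ℚ] K) h4 hord hξ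
  have hmain := exists_simple_degenerate_of_model_balanced (MulEquiv.refl (K ≃ₐ[ℚ] K)) (α ^ h)
    (by rw [MulEquiv.refl_apply, hc]) T
    (fun x => doubleInterval_cm (by omega) hord hξ hcard hTr hTx x)
    (doubleInterval_leftStabiliser' h4 hord hξ hrel hξ2 hu1 hu2 hcard hTr hTx)
    {(1 : K ≃ₐ[ℚ] K), α ^ ((h - 1 : ℕ) : ZMod (2 * h)).val,
      α ^ ((h : ℕ) : ZMod (2 * h)).val * ξ, α ^ ((2 * h - 1 : ℕ) : ZMod (2 * h)).val * ξ}
    (fun g => by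
      have hn1 : (1 : K ≃ₐ[ℚ] K) ∉ ({α ^ ((h - 1 : ℕ) : ZMod (2 * h)).val, α ^ ((h : ℕ) : ZMod (2 * h)).val * ξ,
          α ^ ((2 * h - 1 : ℕ) : ZMod (2 * h)).val * ξ} : Finset (K ≃ₐ[ℚ] K)) := by
        simp only [Finset.mem_insert, Finset.mem_singleton, not_or]; exact ⟨hne12, hne13, hne14⟩
      have hn2 : α ^ ((h - 1 : ℕ) : ZMod (2 * h)).val ∉ ({α ^ ((h : ℕ) : ZMod (2 * h)).val * ξ,
          α ^ ((2 * h - 1 : ℕ) : ZMod (2 * h)).val * ξ} : Finset (K ≃ₐ[ℚ] K)) := by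
        simp only [Finset.mem_insert, Finset.mem_singleton, not_or]; exact ⟨hne23, hne24⟩
      have hn3 : α ^ ((h : ℕ) : ZMod (2 * h)).val * ξ ∉
          ({α ^ ((2 * h - 1 : ℕ) : ZMod (2 * h)).val * ξ} : Finset (K ≃ₐ[ℚ] K)) := by
        simp only [Finset.mem_singleton]; exact hne34
      rw [doubleInterval_balanced' h4 hord hξ hrel hξ2 hcard hTr hTx g, Finset.card_insert_of_notMem hn1,
        Finset.card_insert_of_notMem hn2, Finset.card_insert_of_notMem hn3, Finset.card_singleton])
    ⟨1, by simp, by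
      rw [mul_one, hαh]
      simp only [Finset.mem_insert, Finset.mem_singleton, not_or]
      refine ⟨fun heq => ?_, fun heq => ?_, pow_val_ne_pow_val_mul hξ _ _, pow_val_ne_pow_val_mul hξ _ _⟩
      · have e0 : (1 : K ≃ₐ[ℚ] K) = α ^ (0 : ZMod (2 * h)).val := by rw [ZMod.val_zero, pow_zero]
        rw [e0] at heq
        have := congrArg ZMod.val ((pow_val_inj hord).1 heq)
        rw [val_natCast_of_lt' (show h < 2 * h by omega), ZMod.val_zero] at this
        omega
      · have := congrArg ZMod.val ((pow_val_inj hord).1 heq)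
        rw [val_natCast_of_lt' (show h < 2 * h by omega), val_natCast_of_lt' (show h - 1 < 2 * h by omega)] at this
        omega⟩
  rwa [hcard, show 4 * h / 2 = 2 * h by omega] at hmain

end Field

end Summit.HodgeConjecture.CorCM.GaloisSemidihedral

end
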